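import Mathlib
import Literature.Analysis.FluidPDE.VectorCalculus
import Summits.NavierStokesRegularity.NavierStokesRegularity.Theorems.FilamentSkeletonRssClause13RAdjointPunctured
import Summits.NavierStokesRegularity.NavierStokesRegularity.Theorems.FilamentSkeletonRssClause13RAdjointNonlocalCompact
import Summits.NavierStokesRegularity.NavierStokesRegularity.Theorems.FilamentSkeletonRssClause13RAdjointWaistOperator

/-!
# Clause 13-R, STUB R at MODEL level: EXISTENCE for the sourced nonlocal model adjoint equation in the bounded punctured class
# — census item (R-c′-E) CLOSED at model level by the Fredholm alternative (crux `Clause13RNearStraightL`, stmt-NavierStokesRegularity-23612;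
# line `rate_bordered_split`, STUB R `stub_rateRow13RFlat`)

Route `FilamentSkeletonRss`, Variant A1R.  The MODEL adjoint equation of the rate row on the tangency ball `S = [a, b]` with a source `g`,
  `cst • (m σ • (φ σ × d) − ∫_{τ∈S} k(τ−σ) • (φ τ × d) dτ) + ½ φ σ + α e × φ σ + w′ σ φ σ + w σ φ′ σ = g σ`   (`σ ∈ S ∖ {c}`),
slip `w ∈ C¹` vanishing at the waist `c ∈ (a, b)` and opening at least linearly, even continuous kernel `k`, continuous weight `m`.  On the tree: in the
class «differentiable on `S ∖ {c}`, bounded on `S`» solutions are UNIQUE (`…Clause13RAdjointPuncturedUnique` p832285, from the improper energy identity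
`…Clause13RAdjointPunctured` p832184 under `w′ ≥ −1 + 2ε`) and `L²`-controlled by the source (`…PuncturedApriori` p832351); the exit reports of hands
fsrs-19-g1/22/23 listed EXISTENCE as the remaining model item (R-c′-E) and recorded its Fredholm step as a library gap.  It is not: Mathlib has the
Fredholm alternative for compact operators (`IsCompactOperator.hasEigenvalue_or_mem_resolventSet`).  THIS FILE closes (R-c′-E) at model level:
`exists_model_adjoint_punctured_solution` — for EVERY continuous source `g` there is a density `φ`, CONTINUOUS on `S`, differentiable on `S ∖ {c}`
(two-sided, endpoints included), bounded on `S`, solving the sourced nonlocal equation at every station of `S ∖ {c}`.  Proof: with the compact nonlocal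
operator `N` (`…Clause13RAdjointNonlocalCompact` p837224) and the bounded waist-regular local solution operator `Φ` (`…Clause13RAdjointWaistOperator`), the
equation is the fixed-point problem `φ = Φ(g + cst·Nφ)` on `C(S; ℝ³)`; `T = cst·Φ∘N` is compact; an eigenvector `Tφ = φ` would be a bounded punctured
solution of the HOMOGENEOUS equation, hence zero by p832184 — so `1` is in the resolvent set and `φ − Tφ = Φg` is solvable.  In particular the
edge-sourced equation of `…Clause13REdgeMeasureModel` (p829163) has its density for every pair of edge atoms: the model-level (C⁰)*-cokernel programme of
STUB R is complete up to clause transfer (R-c″) and the kit confirmation (R-S1).  [folklore] (Riesz–Schauder theory for a compact perturbation of an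
invertible operator).
Hand `leafhand-ns-filamentskeletonrs-25-g0` (LAND-ONLY); `--supports stmt-NavierStokesRegularity-23612` helper, def-free.  HONEST FRAMING: an existence
statement for the MODEL adjoint equation attached to a HYPOTHETICAL filament skeleton on the NEGATIVE side of a MODEL blow-up route; STUB R is NOT proved
here (no clause transfer, no pairing floor) and nothing in this file bears on Navier–Stokes regularity or blow-up.
-/

noncomputable section

open MeasureTheory Filter Topology Set Metric
open scoped RealInnerProductSpace InnerProductSpace BoundedContinuousFunction
open Literature.Analysis.FluidPDE
open Summit.NavierStokesRegularity.NavierStokesRegularity.Theorems.Clause13RAdjointPunctured (model_adjoint_no_bounded_punctured_annihilator)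
open Summit.NavierStokesRegularity.NavierStokesRegularity.Theorems.Clause13RAdjointNonlocalCompact (exists_nonlocal_compactOperator)
open Summit.NavierStokesRegularity.NavierStokesRegularity.Theorems.Clause13RAdjointWaistOperator (exists_waist_solutionOperator)

namespace Summit.NavierStokesRegularity.NavierStokesRegularity.Theorems.Clause13RAdjointModelExistence
set_option linter.dupNamespace false

/-! ## §1 From the local form with the nonlocal term in the source to the full equation -/

/-- Rearrangement: the local sourced equation with source `gx + cst • I` is the full nonlocal equation with source `gx`. [folklore] -/
theorem full_of_local {wv wp α cst mσ : ℝ} {x y gx I : EuclideanSpace ℝ (Fin 3)} {d e : EuclideanSpace ℝ (Fin 3)}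
    (h : wv • y + (1 / 2 : ℝ) • x + wp • x + α • cross e x + (cst * mσ) • cross x d = gx + cst • I) :
    cst • (mσ • cross x d - I) + (1 / 2 : ℝ) • x + α • cross e x + wp • x + wv • y = gx := by
  have h' : gx = wv • y + (1 / 2 : ℝ) • x + wp • x + α • cross e x + (cst * mσ) • cross x d - cst • I :=
    eq_sub_of_add_eq h.symm
  rw [h', smul_sub, mul_smul]
  abel

/-! ## §2 Existence in the bounded punctured class (Fredholm alternative) -/

/-- **EXISTENCE FOR THE SOURCED NONLOCAL MODEL ADJOINT EQUATION (census item (R-c′-E), model level).**  Ball `[a, b] ∋ c` inside an open interval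
`(a₀, b₀)` on which the `C¹` slip `w` (`w′` continuous, `w(c) = 0`) opens at least linearly on both sides of the waist (`κ₁ > 0`) and satisfies
`w′ ≥ −1 + 2ε` on `[a, b]`; even continuous kernel `k`, continuous weight `m`, constants `cst, α`, vectors `d, e`.  Then for every continuous source `g`
there are `φ, φ′` with `φ` continuous on `[a, b]`, `HasDerivAt φ (φ′ σ) σ` at every `σ ∈ [a, b] ∖ {c}`, `φ` bounded on `[a, b]`, and
`cst • (m σ • (φ σ × d) − ∫_{τ∈[a,b]} k(τ−σ) • (φ τ × d) dτ) + ½ φ σ + α e × φ σ + w′ σ φ σ + w σ φ′ σ = g σ` for all `σ ∈ [a, b] ∖ {c}` — the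
input class of `…Clause13RAdjointPuncturedUnique.sourced_density_unique_of_bounded`, in which the solution is therefore unique. [folklore] -/
theorem exists_model_adjoint_punctured_solution {a₀ a c b b₀ κ₁ ε cst α : ℝ} {k m w w' : ℝ → ℝ} {d e : EuclideanSpace ℝ (Fin 3)}
    (h₀ : a₀ < a) (hac : a < c) (hcb : c < b) (h₁ : b < b₀) (hκ₁ : 0 < κ₁) (hε : 0 < ε)
    (hk : Continuous k) (hkev : ∀ s, k (-s) = k s)
    (hw : ∀ s, HasDerivAt w (w' s) s) (hw'c : Continuous w') (hm : Continuous m) (hwc0 : w c = 0)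
    (hwR : ∀ s ∈ Icc c b₀, κ₁ * (s - c) ≤ w s) (hwL : ∀ s ∈ Icc a₀ c, κ₁ * (c - s) ≤ -w s)
    (hgrowth : ∀ σ ∈ Icc a b, -1 + 2 * ε ≤ w' σ) {g : ℝ → EuclideanSpace ℝ (Fin 3)} (hg : Continuous g) :
    ∃ φ φ' : ℝ → EuclideanSpace ℝ (Fin 3),
      ContinuousOn φ (Icc a b) ∧
      (∀ σ ∈ Icc a b, σ ≠ c → HasDerivAt φ (φ' σ) σ) ∧
      (∃ M : ℝ, ∀ σ ∈ Icc a b, ‖φ σ‖ ≤ M) ∧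
      (∀ σ ∈ Icc a b, σ ≠ c →
        cst • (m σ • cross (φ σ) d - ∫ τ in Icc a b, k (τ - σ) • cross (φ τ) d)
          + (1 / 2 : ℝ) • φ σ + α • cross e (φ σ) + w' σ • φ σ + w σ • φ' σ = g σ) := by
  have hab : a ≤ b := (hac.trans hcb).le
  have hIsub : Icc a b ⊆ Ioo a₀ b₀ := fun x hx => ⟨h₀.trans_le hx.1, lt_of_le_of_lt hx.2 h₁⟩
  -- the two operators
  obtain ⟨N, hN_apply, hNc⟩ := exists_nonlocal_compactOperator hab hk d
  obtain ⟨Φ, Ψ, Ψ', hΦ⟩ := exists_waist_solutionOperator (α := α) (cst := cst) (m := m) (d := d) (e := e) hab h₀ hac hcb h₁ hκ₁ hw hw'c hm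
    hwc0 hwR hwL
  set T : (Icc a b →ᵇ EuclideanSpace ℝ (Fin 3)) →L[ℝ] (Icc a b →ᵇ EuclideanSpace ℝ (Fin 3)) := cst • Φ.comp N with hT
  have hT_apply : ∀ v, T v = cst • Φ (N v) := fun v => rfl
  have hTc : IsCompactOperator T := by
    have h := (hNc.clm_comp Φ).smul cst
    have hfun : (T : (Icc a b →ᵇ EuclideanSpace ℝ (Fin 3)) → (Icc a b →ᵇ EuclideanSpace ℝ (Fin 3))) = cst • ((Φ : _ → _) ∘ (N : _ → _)) := by
      ext v σ
      rfl
    rw [hfun]; exact h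
  -- reading a fixed point back as a punctured solution: the common part of both Fredholm branches
  have hread : ∀ (src v : Icc a b →ᵇ EuclideanSpace ℝ (Fin 3)) (gr : ℝ → EuclideanSpace ℝ (Fin 3)),
      v = Φ src → (∀ σ (hσ : σ ∈ Icc a b), IccExtend hab src σ = gr σ + cst • N v ⟨σ, hσ⟩) →
      (ContinuousOn (Ψ src) (Icc a b)) ∧
      (∀ σ ∈ Icc a b, σ ≠ c → HasDerivAt (Ψ src) (Ψ' src σ) σ) ∧
      (∀ σ ∈ Icc a b, ‖Ψ src σ‖ ≤ ‖src‖ / κ₁) ∧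
      (∀ σ (hσ : σ ∈ Icc a b), (v : Icc a b → EuclideanSpace ℝ (Fin 3)) ⟨σ, hσ⟩ = Ψ src σ) ∧
      (∀ σ ∈ Icc a b, σ ≠ c →
        cst • (m σ • cross (Ψ src σ) d - ∫ τ in Icc a b, k (τ - σ) • cross (Ψ src τ) d)
          + (1 / 2 : ℝ) • Ψ src σ + α • cross e (Ψ src σ) + w' σ • Ψ src σ + w σ • Ψ' src σ = gr σ) := by
    intro src v gr hv hsrc
    obtain ⟨hΦΨ, hΨc, hΨd, hΨeq, -, hΨs⟩ := hΦ src
    have hvΨ : ∀ σ (hσ : σ ∈ Icc a b), (v : Icc a b → EuclideanSpace ℝ (Fin 3)) ⟨σ, hσ⟩ = Ψ src σ := fun σ hσ => by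
      rw [hv]; exact hΦΨ ⟨σ, hσ⟩
    have hext : ∀ τ ∈ Icc a b, IccExtend hab v τ = Ψ src τ := fun τ hτ => by
      rw [Set.IccExtend_of_mem hab v hτ]; exact hvΨ τ hτ
    have hN' : ∀ σ (hσ : σ ∈ Icc a b), N v ⟨σ, hσ⟩ = ∫ τ in Icc a b, k (τ - σ) • cross (Ψ src τ) d := fun σ hσ => by
      rw [hN_apply v ⟨σ, hσ⟩]
      exact setIntegral_congr_fun measurableSet_Icc fun τ hτ => by rw [hext τ hτ]
    refine ⟨hΨc.mono hIsub, fun σ hσ hσc => hΨd σ (hIsub hσ) hσc, fun σ hσ => hΨs σ (hIsub hσ), hvΨ, fun σ hσ hσc => ?_⟩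
    have h := hΨeq σ (hIsub hσ) hσc
    rw [hsrc σ hσ, hN' σ hσ] at h
    exact full_of_local h
  -- the Fredholm alternative for `T`
  rcases hTc.hasEigenvalue_or_mem_resolventSet (μ := (1 : ℝ)) one_ne_zero with hEig | hRes
  · -- an eigenvector would be a nonzero bounded punctured solution of the HOMOGENEOUS equation: impossible
    exfalso
    obtain ⟨v, hv⟩ := hEig.exists_hasEigenvector
    have hv0 : v ≠ 0 := (Module.End.hasEigenvector_iff.1 hv).2
    have hTv : T v = v := by
      have h := hv.apply_eq_smul
      rw [one_smul] at h
      exact h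
    set src : Icc a b →ᵇ EuclideanSpace ℝ (Fin 3) := cst • N v with hsrc
    have hvΦ : v = Φ src := by rw [hsrc, map_smul, ← hT_apply, hTv]
    have hsrcext : ∀ σ (hσ : σ ∈ Icc a b), IccExtend hab src σ = (fun _ => (0 : EuclideanSpace ℝ (Fin 3))) σ + cst • N v ⟨σ, hσ⟩ :=
      fun σ hσ => by
        rw [Set.IccExtend_of_mem hab src hσ, zero_add]; rfl
    obtain ⟨-, hd, hb, hvΨ, heq⟩ := hread src v (fun _ => 0) hvΦ hsrcext
    have hwa : w a ≤ 0 := by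
      have := hwL a ⟨h₀.le, hac.le⟩; nlinarith [mul_pos hκ₁ (sub_pos.2 hac)]
    have hwb : 0 ≤ w b := (mul_nonneg hκ₁.le (sub_nonneg.2 hcb.le)).trans (hwR b ⟨hcb.le, h₁.le⟩)
    have hzero := model_adjoint_no_bounded_punctured_annihilator (φ := Ψ src) (φ' := Ψ' src) (M := ‖src‖ / κ₁) hac hcb hε hk hkev
      hw hw'c hwc0 hwa hwb hgrowth hd hb heq
    -- the value at the waist vanishes too, by continuity
    obtain ⟨-, hΨc, -, -, -, -⟩ := hΦ src
    have hcat : ContinuousAt (Ψ src) c := (hΨc c ⟨h₀.trans hac, hcb.trans h₁⟩).continuousAt (Ioo_mem_nhds (h₀.trans hac) (hcb.trans h₁))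
    have hlim1 : Tendsto (Ψ src) (𝓝[>] c) (𝓝 (Ψ src c)) := hcat.tendsto.mono_left nhdsWithin_le_nhds
    have hlim0 : Tendsto (Ψ src) (𝓝[>] c) (𝓝 0) := by
      refine (tendsto_const_nhds (x := (0 : EuclideanSpace ℝ (Fin 3)))).congr' ?_
      exact eventually_of_mem (Ioo_mem_nhdsGT hcb) fun s hs => (hzero s ⟨hac.le.trans hs.1.le, hs.2.le⟩ (ne_of_gt hs.1)).symm
    have hΨc0 : Ψ src c = 0 := tendsto_nhds_unique hlim1 hlim0
    apply hv0
    ext σ : 1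
    have h := hvΨ σ σ.2
    rw [BoundedContinuousFunction.coe_zero, Pi.zero_apply]
    rw [show v σ = Ψ src σ from h]
    by_cases hσc : (σ : ℝ) = c
    · rw [hσc, hΨc0]
    · exact hzero σ σ.2 hσc
  · -- `1` is in the resolvent set: solve `v - T v = Φ gX`
    have hunit : IsUnit ((1 : (Icc a b →ᵇ EuclideanSpace ℝ (Fin 3)) →L[ℝ] (Icc a b →ᵇ EuclideanSpace ℝ (Fin 3))) - T) := by
      have h := spectrum.mem_resolventSet_iff.1 hRes
      rwa [map_one] at h
    obtain ⟨-, hsurj⟩ := ContinuousLinearMap.isUnit_iff_bijective.1 hunit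
    set gX : Icc a b →ᵇ EuclideanSpace ℝ (Fin 3) :=
      BoundedContinuousFunction.mkOfCompact ⟨fun σ : Icc a b => g σ, hg.comp continuous_subtype_val⟩ with hgX
    obtain ⟨v, hv⟩ := hsurj (Φ gX)
    have hv' : v = Φ gX + T v := by
      have : ((1 : (Icc a b →ᵇ EuclideanSpace ℝ (Fin 3)) →L[ℝ] (Icc a b →ᵇ EuclideanSpace ℝ (Fin 3))) - T) v = v - T v := rfl
      rw [this] at hv
      rw [← hv]; abel
    set src : Icc a b →ᵇ EuclideanSpace ℝ (Fin 3) := gX + cst • N v with hsrc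
    have hvΦ : v = Φ src := by rw [hsrc, map_add, map_smul, ← hT_apply]; exact hv'
    have hsrcext : ∀ σ (hσ : σ ∈ Icc a b), IccExtend hab src σ = g σ + cst • N v ⟨σ, hσ⟩ := fun σ hσ => by
      rw [Set.IccExtend_of_mem hab src hσ]; rfl
    obtain ⟨hc, hd, hb, -, heq⟩ := hread src v g hvΦ hsrcext
    exact ⟨Ψ src, Ψ' src, hc, hd, ⟨‖src‖ / κ₁, hb⟩, heq⟩

end Summit.NavierStokesRegularity.NavierStokesRegularity.Theorems.Clause13RAdjointModelExistence

end
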